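import Summits.QuantumFields.GaugeBoot.MMRowSU2D4
import HarnessLib

/-!
# Row algebra for bindings: linear combinations, evaluation at a rational coupling, order-free comparison (LEQ-SCALING R2⁺)

Cell `pub-gaugeboot` (HOME `run/shared/lean/pub/pub-gaugeboot/`), seat lean2 — companion of `MMRowSU2.lean` / `MMRowSU2D4.lean`.

HONEST FRAMING (page 1 of every file of this cell): certified bounds on lattice expectations at STATED coupling, gauge
group, dimension and torus size; NOT a mass gap, NOT a continuum limit, NOT a string tension, NOT large `N`; NOT
Yang–Mills-summit-bearing (barriers `FixedCouplingUltralocality`, `PerturbativeInvisibility`).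

## Why

The rows-as-data modules (`GLYZc2D3*`, `KZL2D3*`, `KZL2rpD3*`, `GLYZc1D4*`, `KZL2D4*`, `GLYZc2D4*`) make every row of eng1's G1
`leq1` files a theorem `rowSum β L (mmRowSU2 X cs) = 0`.  The CERTIFIED problem files of rows C1–C2, C15–C19, C20–C40 carry the
equality system in eng2's REDUCED form (`G2:direct(rref)`: each problem row is a rational linear combination of the generators'
direct rows, coefficients depending on `β`; the two spans agree — K1 — and the seat's exact check `span_check.py` finds every problem
row in the span of the theorem rows: kz-L2-H 585/585, kz-L2-rp 1662/1662, glyz-c2 346/346, glyz-c1-4D 204/204 at the checked `β`).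
A binding therefore needs: linear combinations of rows, evaluation of the `β`-affine coefficients at the problem's rational `β₀`, and
a comparison of rows that ignores term order and merging.  This file provides them ONCE, for any label type `α` (so for `Word 3` and
`Word 4` alike) and any valuation `v : α → ℝ` (`Rung0D3.W β L`, `Rung0D4.W β L`):

* `rowVal β v r = Σ (c0 + c1·β/8)·v(label)`; `rowSum β L r = rowVal β (Rung0D3.W β L) r` and `rowSum4 … = rowVal β (Rung0D4.W β L) …`
  hold by `rfl` (`rowSum_eq_rowVal`, `rowSum4_eq_rowVal`);
* `GRow.smul`, `GRow.lincomb cs` (concatenation of scaled rows) with `rowVal_lincomb_eq_zero`: a combination of vanishing rows vanishes;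
* `GRow.evalAt β₀ r` (coefficients `c0 + c1·β₀/8`, then `c1 = 0`) with `rowVal_evalAt`;
* `GRow.coeff r a` (total coefficient pair of label `a`), `GRow.equiv r s` (Boolean: equal total coefficients on every occurring
  label) and `rowVal_eq_of_equiv` — so `equiv (problemRow) (lincomb data) = true` (one `decide`) transfers `= 0` to the problem row
  as written in the problem file (any term order, unmerged duplicates allowed).
Everything is `[folklore]` (finite sums).
-/

noncomputable section

open Literature.MathematicalPhysics.QuantumFieldTheory

namespace Summit.QuantumFields.GaugeBoot

/-- A row over labels `α`: terms `(label, c0, c1)`, coefficient `c0 + c1·β/8`. [folklore] -/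
abbrev GRow (α : Type) : Type := List (α × ℚ × ℚ)

section RowVal

variable {α : Type}

/-- The value of a row for the valuation `v` at standard coupling `β`: `Σ (c0 + c1·β/8)·v(label)`. [folklore] -/
def rowVal (β : ℝ) (v : α → ℝ) (r : GRow α) : ℝ :=
  (r.map fun t => (((t.2.1 : ℚ) : ℝ) + ((t.2.2 : ℚ) : ℝ) * (β / 8)) * v t.1).sum

variable (β : ℝ) (v : α → ℝ)

/-- Unfolding lemma `rowVal_nil`. [folklore] -/
@[simp] theorem rowVal_nil : rowVal β v [] = 0 := rfl

/-- Unfolding lemma `rowVal_cons`. [folklore] -/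
@[simp] theorem rowVal_cons (t : α × ℚ × ℚ) (r : GRow α) :
    rowVal β v (t :: r) = (((t.2.1 : ℚ) : ℝ) + ((t.2.2 : ℚ) : ℝ) * (β / 8)) * v t.1 + rowVal β v r := by
  simp [rowVal]

/-- `rowVal` is additive under concatenation. [folklore] -/
@[simp] theorem rowVal_append (r s : GRow α) : rowVal β v (r ++ s) = rowVal β v r + rowVal β v s := by
  simp [rowVal, List.sum_append]

/-- Scale a row by a rational. [folklore] -/
def GRow.smul (a : ℚ) (r : GRow α) : GRow α := r.map fun t => (t.1, a * t.2.1, a * t.2.2)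

/-- `rowVal (a • r) = a · rowVal r`. [folklore] -/
theorem rowVal_smul (a : ℚ) (r : GRow α) : rowVal β v (GRow.smul a r) = (a : ℝ) * rowVal β v r := by
  induction r with
  | nil => simp [GRow.smul]
  | cons t r ih =>
    simp only [GRow.smul, List.map_cons, rowVal_cons] at ih ⊢
    rw [ih]; push_cast; ring

/-- A linear combination of rows: the concatenation of the scaled rows (unmerged). [folklore] -/
def GRow.lincomb (cs : List (ℚ × GRow α)) : GRow α := (cs.map fun p => GRow.smul p.1 p.2).flatten

/-- **A linear combination of vanishing rows vanishes.** [folklore] -/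
theorem rowVal_lincomb_eq_zero (cs : List (ℚ × GRow α)) (h : ∀ p ∈ cs, rowVal β v p.2 = 0) :
    rowVal β v (GRow.lincomb cs) = 0 := by
  induction cs with
  | nil => simp [GRow.lincomb]
  | cons p cs ih =>
    have hp := h p (by simp)
    have ih' := ih fun q hq => h q (by simp [hq])
    simp only [GRow.lincomb, List.map_cons, List.flatten_cons, rowVal_append] at ih' ⊢
    rw [rowVal_smul, hp, ih']; simp

/-- Evaluate the `β`-affine coefficients at a rational coupling `β₀`: terms `(label, c0 + c1·β₀/8, 0)`. [folklore] -/
def GRow.evalAt (β₀ : ℚ) (r : GRow α) : GRow α := r.map fun t => (t.1, t.2.1 + t.2.2 * β₀ / 8, 0)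

omit β in
/-- `rowVal` at the real coupling `β₀` of the evaluated row is `rowVal` at `β₀` of the row. [folklore] -/
theorem rowVal_evalAt (β₀ : ℚ) (r : GRow α) : rowVal (β₀ : ℝ) v (GRow.evalAt β₀ r) = rowVal (β₀ : ℝ) v r := by
  induction r with
  | nil => simp [GRow.evalAt]
  | cons t r ih =>
    simp only [GRow.evalAt, List.map_cons, rowVal_cons] at ih ⊢
    rw [ih]; push_cast; ring

variable [DecidableEq α]

/-- The total coefficient pair of the label `a` in the row (sum over all its occurrences). [folklore] -/
def GRow.coeff (r : GRow α) (a : α) : ℚ × ℚ :=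
  (((r.filter fun t => t.1 = a).map fun t => t.2.1).sum, ((r.filter fun t => t.1 = a).map fun t => t.2.2).sum)

/-- Unfolding lemma `coeff_nil`. [folklore] -/
@[simp] theorem GRow.coeff_nil (a : α) : GRow.coeff ([] : GRow α) a = (0, 0) := by simp [GRow.coeff]

/-- Unfolding lemma `coeff_cons`. [folklore] -/
theorem GRow.coeff_cons (t : α × ℚ × ℚ) (r : GRow α) (a : α) :
    GRow.coeff (t :: r) a = if t.1 = a then (t.2.1 + (GRow.coeff r a).1, t.2.2 + (GRow.coeff r a).2) else GRow.coeff r a := by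
  unfold GRow.coeff
  by_cases h : t.1 = a
  · simp [h]
  · simp [h]

/-- The value contributed by a label: `(coeff.1 + coeff.2·β/8)·v a`. [folklore] -/
def coeffVal (r : GRow α) (a : α) : ℝ :=
  ((((GRow.coeff r a).1 : ℚ) : ℝ) + (((GRow.coeff r a).2 : ℚ) : ℝ) * (β / 8)) * v a

/-- A label that does not occur contributes nothing. [folklore] -/
theorem coeffVal_eq_zero_of_not_mem (r : GRow α) (a : α) (h : a ∉ r.map Prod.fst) : coeffVal β v r a = 0 := by
  induction r with
  | nil => simp [coeffVal]
  | cons t r ih =>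
    have h1 : t.1 ≠ a := fun e => h (by simp [e])
    have h2 : a ∉ r.map Prod.fst := fun e => h (by simp [e])
    have := ih h2
    simp only [coeffVal, GRow.coeff_cons, h1, if_false] at this ⊢
    exact this

/-- **The value of a row is the sum of the contributions of its labels** (over any finset containing them). [folklore] -/
theorem rowVal_eq_sum_coeffVal (r : GRow α) (S : Finset α) (hS : ∀ a ∈ r.map Prod.fst, a ∈ S) :
    rowVal β v r = ∑ a ∈ S, coeffVal β v r a := by
  induction r with
  | nil => simp [coeffVal]
  | cons t r ih =>
    have ht : t.1 ∈ S := hS t.1 (by simp)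
    have ih' := ih fun a ha => hS a (by simp [ha])
    rw [rowVal_cons, ih']
    have hsplit : ∀ a ∈ S, coeffVal β v (t :: r) a =
        (if t.1 = a then (((t.2.1 : ℚ) : ℝ) + ((t.2.2 : ℚ) : ℝ) * (β / 8)) * v a else 0) + coeffVal β v r a := by
      intro a _
      by_cases h : t.1 = a
      · simp only [coeffVal, GRow.coeff_cons, h, if_true]; push_cast; ring
      · simp only [coeffVal, GRow.coeff_cons, h, if_false, zero_add]
    rw [Finset.sum_congr rfl hsplit, Finset.sum_add_distrib, Finset.sum_ite_eq S t.1, if_pos ht]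

/-- Boolean order-free comparison: the two rows give the same total coefficient pair to every label occurring in either. [folklore] -/
def GRow.equiv (r s : GRow α) : Bool :=
  (r.map Prod.fst ++ s.map Prod.fst).all fun a => decide (GRow.coeff r a = GRow.coeff s a)

/-- **Equivalent rows have the same value** (any term order, unmerged duplicates allowed). [folklore] -/
theorem rowVal_eq_of_equiv (r s : GRow α) (h : GRow.equiv r s = true) : rowVal β v r = rowVal β v s := by
  classical
  set S : Finset α := (r.map Prod.fst ++ s.map Prod.fst).toFinset with hSdef
  have hr : ∀ a ∈ r.map Prod.fst, a ∈ S := fun a ha => by simp [hSdef, ha]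
  have hs : ∀ a ∈ s.map Prod.fst, a ∈ S := fun a ha => by simp [hSdef, ha]
  rw [rowVal_eq_sum_coeffVal β v r S hr, rowVal_eq_sum_coeffVal β v s S hs]
  refine Finset.sum_congr rfl fun a ha => ?_
  have ha' : a ∈ r.map Prod.fst ++ s.map Prod.fst := by simpa [hSdef] using ha
  have h' := List.all_eq_true.1 h a ha'
  simp only [decide_eq_true_eq] at h'
  simp only [coeffVal, h']

/-- **Transfer**: a row equivalent to a linear combination of vanishing rows, evaluated at the rational coupling `β₀`, vanishes at
`β₀`. (The shape a binding uses: `h` by `decide`, `hcs` from the data modules' `rowSum_sdₖ` / `rowSum_trₖ`.) [folklore] -/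
theorem rowVal_eq_zero_of_equiv_lincomb (β₀ : ℚ) (r : GRow α) (cs : List (ℚ × GRow α))
    (h : GRow.equiv r (GRow.evalAt β₀ (GRow.lincomb cs)) = true) (hcs : ∀ p ∈ cs, rowVal (β₀ : ℝ) v p.2 = 0) :
    rowVal (β₀ : ℝ) v r = 0 := by
  rw [rowVal_eq_of_equiv (β₀ : ℝ) v r _ h, rowVal_evalAt, rowVal_lincomb_eq_zero _ v cs hcs]

end RowVal

/-! ## Bridges to the cell's rows -/

/-- `rowSum` (`D = 3`) is `rowVal` for the valuation `Rung0D3.W β L`. [folklore] -/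
theorem rowSum_eq_rowVal (β : ℝ) (L : ℕ) [NeZero L] (r : ERow) : rowSum β L r = rowVal β (Rung0D3.W β L) r := rfl

/-- `rowSum4` (`D = 4`) is `rowVal` for the valuation `Rung0D4.W β L`. [folklore] -/
theorem rowSum4_eq_rowVal (β : ℝ) (L : ℕ) [NeZero L] (r : ERow4) : rowSum4 β L r = rowVal β (Rung0D4.W β L) r := rfl

/-- Example (closed computation): `2·(abAB) − (abAB) − (abAB)` written in any order is equivalent to the empty row. [folklore] -/
example : GRow.equiv ([([.fwd 0, .fwd 1, .bwd 0, .bwd 1], 2, 0), ([.fwd 0, .fwd 1, .bwd 0, .bwd 1], -2, 0)] : ERow) [] = true := by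
  decide +kernel

end Summit.QuantumFields.GaugeBoot

end
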